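import Summits.CriticalPhenomena.SAWScalingLimit.Theorems.SAWRenewalTightnessAnnularMassDecayStraddleBlocks
import Mathlib.Algebra.BigOperators.Ring.Finset
import Mathlib.Algebra.BigOperators.Fin
import Mathlib.Data.List.OfFn

/-!
# Crux `SAWRenewalTightness.AnnularMassDecay` (stmt-CriticalPhenomena-4729), line `last-renewal-delocalization`:
# S2b `stub_bridgeCodeCount` — block families are uniquely decodable codes

For a real direction `e ∈ ℂ`, a level `ℓ` and a finite BLOCK FAMILY `B` — blocks `b = (n, w)` with `w` an `n`-step
self-avoiding `e`-bridge from `0`, `1 ≤ n ≤ M`, end height `≥ ℓ`, and the MARKER property: every `e`-renewal time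
`s ∈ [1, n-1]` of `w` has height `< ℓ` — we prove, for every `x > 0` and every `K`, the code-counting inequality
`Σ_{k ≤ K} (Σ_{b ∈ B} x^{n_b})^k ≤ Σ_{n ≤ K M} c_n x^n` (registered stub `stub_bridgeCodeCount` of the checked skeleton
of the line; vocabulary `ht`, `IsBr`, `IsRen`, `catBlocks` from `…AnnularMassDecayLastRenewalDefs`, concatenation API
`lsb_*` from `…AnnularMassDecayStraddleBlocks`).

Proof (Kesten's renewal structure in a real direction, translation only).  Expanding the power, the left side is the
sum of `x^{n₁ + ⋯ + n_k}` over all `k`-tuples of blocks, `k ≤ K` (`Finset.sum_pow'`).  The iterated concatenation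
`catBlocks` of a list of blocks is a self-avoiding `e`-bridge from `0` (each new piece lives strictly above the end of
the previous one, which is its running maximum: `lbc_concat`, `lbc_catBlocks_spec`) of length `≤ k M`.  DECODING
(`lbc_not_lt`, `lbc_cons_inj`, `lbc_decode`): in `Ω = w_b ⊕ Ω'` the junction time `n_b` is a renewal time of `Ω` at
height `≥ ℓ` (`lsb_isRen_mid`), and a renewal time `s < n_b` of `Ω` restricts to a renewal time of `w_b`, hence has
height `< ℓ` by the marker property; so two decompositions have the same first length, hence the same first block
(`SAW.Zd.headPart_concatWalk`) and the same rest (`SAW.Zd.tailPart_concatWalk`), and by induction the whole list is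
determined.  Hence tuples `↦ (total length, catBlocks)` is injective into `Σ_{n ≤ KM} saws 2 n`, whose `x^n`-mass is
`Σ_{n ≤ KM} c_n x^n` (`SAW.Zd.card_saws`).  Sources: H. Kesten, J. Math. Phys. 4 (1963) §4; N. Madras, G. Slade,
*The Self-Avoiding Walk* (1993) §1.2, §4.2 (4.2.1)–(4.2.3); B. Dyhr, M. Gilbert, T. Kennedy, G. F. Lawler, S. Passon,
J. Stat. Phys. 144 (2011) §2.  Pattern in tree (word model): `Literature/…/SAWRenewalBound.lean` (`sum_dseq_le`).
-/

noncomputable section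

namespace Summit.CriticalPhenomena.SAWScalingLimit.Theorems.AnnularMassDecay.LastRenewal

open scoped BigOperators Classical ComplexConjugate
open Literature.Probability.LatticeModels Literature.Probability.RandomPlanarGeometry

/-! ## Concatenation of two `e`-bridges from `0` -/

/-- **The concatenation of two bridges is a bridge** (real direction `e`): for self-avoiding `e`-bridges `β` (`m`
steps) and `γ` (`m'` steps) from `0`, `β ⊕ γ` is self-avoiding — the translated `γ` lives strictly above `h(β_m)`,
which bounds all heights of `β` — and is an `e`-bridge from `0` of `m + m'` steps.
[cite: MadrasSlade1993, §1.2, eq. (1.2.15)] -/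
theorem lbc_concat {e : ℂ} {m m' : ℕ} {β γ : ℕ → Site 2}
    (hβs : β ∈ SAW.Zd.saws 2 m) (hγs : γ ∈ SAW.Zd.saws 2 m') (hβ : IsBr e 0 m β) (hγ : IsBr e 0 m' γ) :
    SAW.Zd.concatWalk m β γ ∈ SAW.Zd.saws 2 (m + m') ∧ IsBr e 0 (m + m') (SAW.Zd.concatWalk m β γ) := by
  have hβ0 : β 0 = 0 := (SAW.Zd.mem_saws.1 hβs).1
  have hγ0 : γ 0 = 0 := (SAW.Zd.mem_saws.1 hγs).1
  have hβ' := (lsb_isBr_zero_iff e m β).1 hβ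
  have hγ' := (lsb_isBr_zero_iff e m' γ).1 hγ
  have hβend : 0 ≤ ht e 0 (β m) := lsb_end_nonneg hβ hβ0
  have hγend : 0 ≤ ht e 0 (γ m') := lsb_end_nonneg hγ hγ0
  refine ⟨?_, ?_⟩
  · refine SAW.Zd.concatWalk_mem_saws hβs hγs fun i hi j hj hjm h => ?_
    have h1 := hβ'.2 i hi
    have h2 := hγ'.1 j hj hjm
    rw [h, ht_zero_add] at h1
    linarith
  · rw [lsb_isBr_zero_iff]
    refine ⟨fun i hi hin => ?_, fun i hin => ?_⟩
    · rcases le_or_gt i m with him | him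
      · rw [lsb_concat_of_le β γ him]
        exact hβ'.1 i hi him
      · obtain ⟨k, rfl⟩ : ∃ k, i = m + k := ⟨i - m, by omega⟩
        rw [lsb_ht_concat_add e β hγ0]
        have h2 := hγ'.1 k (by omega) (by omega)
        linarith
    · rw [lsb_ht_concat_add e β hγ0 m']
      rcases le_or_gt i m with him | him
      · rw [lsb_concat_of_le β γ him]
        have h1 := hβ'.2 i him
        linarith
      · obtain ⟨k, rfl⟩ : ∃ k, i = m + k := ⟨i - m, by omega⟩
        rw [lsb_ht_concat_add e β hγ0, add_le_add_iff_left]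
        exact hγ'.2 k (by omega)

/-! ## Iterated concatenation of blocks: the invariant -/

/-- **Invariant of `catBlocks`.**  For a list of blocks of a block family `B` (lengths in `[1, M]`, self-avoiding
`e`-bridges from `0`), `catBlocks L = (n, Ω)` has `Ω ∈ saws 2 n`, `Ω` an `e`-bridge from `0` of `n` steps, and
`n ≤ |L| · M` (induction on `L` with `lbc_concat`; the empty list gives the trivial walk).
[cite: MadrasSlade1993, §1.2, eq. (1.2.15)] -/
theorem lbc_catBlocks_spec {e : ℂ} {ℓ : ℝ} {B : Finset (ℕ × (ℕ → Site 2))} {M : ℕ}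
    (hB : ∀ b ∈ B, 1 ≤ b.1 ∧ b.1 ≤ M ∧ b.2 ∈ SAW.Zd.saws 2 b.1 ∧ IsBr e 0 b.1 b.2 ∧ ℓ ≤ ht e 0 (b.2 b.1) ∧
      ∀ s, 1 ≤ s → s < b.1 → IsRen e 0 b.2 b.1 s → ht e 0 (b.2 s) < ℓ) :
    ∀ L : List (ℕ × (ℕ → Site 2)), (∀ c ∈ L, c ∈ B) →
      (catBlocks L).2 ∈ SAW.Zd.saws 2 (catBlocks L).1 ∧ IsBr e 0 (catBlocks L).1 (catBlocks L).2 ∧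
        (catBlocks L).1 ≤ L.length * M := by
  intro L
  induction L with
  | nil =>
    intro _
    refine ⟨Negative.const_zero_mem_saws, ⟨fun i hi hi0 => ?_, fun i _ => le_rfl⟩, Nat.zero_le _⟩
    simp only [catBlocks_nil] at hi0
    omega
  | cons b L ih =>
    intro hL
    obtain ⟨-, hbM, hbs, hbbr, -, -⟩ := hB b (hL b (List.mem_cons.2 (Or.inl rfl)))
    obtain ⟨hs, hbr, hlen⟩ := ih fun c hc => hL c (List.mem_cons.2 (Or.inr hc))
    obtain ⟨hs', hbr'⟩ := lbc_concat hbs hs hbbr hbr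
    refine ⟨hs', hbr', ?_⟩
    simp only [catBlocks_cons, List.length_cons]
    have h1 : (L.length + 1) * M = L.length * M + M := Nat.succ_mul _ _
    omega

/-! ## Decoding: the first block of a concatenation is determined -/

/-- **The first junction is the first marked renewal.**  If `w ⊕ γ = w' ⊕ γ'` with the same total length, where `w`
is an `e`-bridge (`n ≥ 1` steps) of end height `≥ ℓ`, `γ` an `e`-bridge from `0`, and `w'` (`k` steps) has the marker
property (renewal times in `[1, k-1]` at height `< ℓ`), then `¬ n < k`: otherwise the junction `n` — a renewal time of
the common walk (`lsb_isRen_mid`) — restricts to a renewal time of `w'` in `[1, k-1]` at height `h(w_n) ≥ ℓ`.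
[cite: Kesten1963SAW, §4] -/
theorem lbc_not_lt {e : ℂ} {ℓ : ℝ} {n n' k k' : ℕ} {w γ w' γ' : ℕ → Site 2}
    (hbr : IsBr e 0 n w) (hℓ : ℓ ≤ ht e 0 (w n)) (hγ : IsBr e 0 n' γ) (hγ0 : γ 0 = 0)
    (hmark' : ∀ s, 1 ≤ s → s < k → IsRen e 0 w' k s → ht e 0 (w' s) < ℓ) (hn1 : 1 ≤ n)
    (hlen : n + n' = k + k') (hw : SAW.Zd.concatWalk n w γ = SAW.Zd.concatWalk k w' γ') :
    ¬ n < k := by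
  intro hlt
  have hren := lsb_isRen_mid hbr hγ hγ0
  rw [hw, hlen] at hren
  obtain ⟨hp, hf⟩ := hren
  have hren' : IsRen e 0 w' k n := by
    refine ⟨fun i hi => ?_, fun j hj hjk => ?_⟩
    · have h1 := hp i hi
      rwa [lsb_concat_of_le w' γ' (show i ≤ k by omega), lsb_concat_of_le w' γ' hlt.le] at h1
    · have h1 := hf j hj (by omega)
      rwa [lsb_concat_of_le w' γ' hlt.le, lsb_concat_of_le w' γ' hjk] at h1
  have h1 := hmark' n hn1 hlt hren'
  have h2 : w' n = w n := by
    rw [← lsb_concat_of_le w' γ' hlt.le, ← hw, lsb_concat_of_le w γ (le_refl n)]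
  rw [h2] at h1
  linarith

/-- **Decoding one block.**  In a block family `B`, if `b :: L` and `b' :: L'` (all blocks in `B`) have the same
`catBlocks` (total length and walk), then `b = b'` and `catBlocks L = catBlocks L'`: the first lengths agree by
`lbc_not_lt` (both ways), then `SAW.Zd.headPart_concatWalk` / `SAW.Zd.tailPart_concatWalk` recover the pieces.
[cite: Kesten1963SAW, §4] -/
theorem lbc_cons_inj {e : ℂ} {ℓ : ℝ} {B : Finset (ℕ × (ℕ → Site 2))} {M : ℕ}
    (hB : ∀ b ∈ B, 1 ≤ b.1 ∧ b.1 ≤ M ∧ b.2 ∈ SAW.Zd.saws 2 b.1 ∧ IsBr e 0 b.1 b.2 ∧ ℓ ≤ ht e 0 (b.2 b.1) ∧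
      ∀ s, 1 ≤ s → s < b.1 → IsRen e 0 b.2 b.1 s → ht e 0 (b.2 s) < ℓ)
    {b b' : ℕ × (ℕ → Site 2)} {L L' : List (ℕ × (ℕ → Site 2))} (hb : b ∈ B) (hb' : b' ∈ B)
    (hL : ∀ c ∈ L, c ∈ B) (hL' : ∀ c ∈ L', c ∈ B) (h : catBlocks (b :: L) = catBlocks (b' :: L')) :
    b = b' ∧ catBlocks L = catBlocks L' := by
  obtain ⟨hb1, -, hbs, hbbr, hbℓ, hbmark⟩ := hB b hb
  obtain ⟨hb1', -, hbs', hbbr', hbℓ', hbmark'⟩ := hB b' hb'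
  obtain ⟨hs, hbr, -⟩ := lbc_catBlocks_spec hB L hL
  obtain ⟨hs', hbr', -⟩ := lbc_catBlocks_spec hB L' hL'
  simp only [catBlocks_cons, Prod.mk.injEq] at h
  obtain ⟨hlen, hw⟩ := h
  have hγ0 : (catBlocks L).2 0 = 0 := (SAW.Zd.mem_saws.1 hs).1
  have hγ0' : (catBlocks L').2 0 = 0 := (SAW.Zd.mem_saws.1 hs').1
  have h1 := lbc_not_lt hbbr hbℓ hbr hγ0 hbmark' hb1 hlen hw
  have h2 := lbc_not_lt hbbr' hbℓ' hbr' hγ0' hbmark hb1' hlen.symm hw.symm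
  have hn : b.1 = b'.1 := by omega
  have hn' : (catBlocks L).1 = (catBlocks L').1 := by omega
  have hww : b.2 = b'.2 := by
    rw [← SAW.Zd.headPart_concatWalk hbs (catBlocks L).2, hw, hn, SAW.Zd.headPart_concatWalk hbs']
  have htail : (catBlocks L).2 = (catBlocks L').2 := by
    rw [← SAW.Zd.tailPart_concatWalk (m := b.1) b.2 hs, hw, hn, hn', SAW.Zd.tailPart_concatWalk b'.2 hs']
  exact ⟨Prod.ext hn hww, Prod.ext hn' htail⟩

/-- **Unique decoding** (Kesten): in a block family `B`, two lists of blocks with the same `catBlocks` are equal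
(induction: the empty list is the only one of total length `0`, as `n_b ≥ 1`; otherwise peel off the first block
with `lbc_cons_inj`). [cite: Kesten1963SAW, §4] -/
theorem lbc_decode {e : ℂ} {ℓ : ℝ} {B : Finset (ℕ × (ℕ → Site 2))} {M : ℕ}
    (hB : ∀ b ∈ B, 1 ≤ b.1 ∧ b.1 ≤ M ∧ b.2 ∈ SAW.Zd.saws 2 b.1 ∧ IsBr e 0 b.1 b.2 ∧ ℓ ≤ ht e 0 (b.2 b.1) ∧
      ∀ s, 1 ≤ s → s < b.1 → IsRen e 0 b.2 b.1 s → ht e 0 (b.2 s) < ℓ) :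
    ∀ L L' : List (ℕ × (ℕ → Site 2)), (∀ c ∈ L, c ∈ B) → (∀ c ∈ L', c ∈ B) →
      catBlocks L = catBlocks L' → L = L' := by
  intro L
  induction L with
  | nil =>
    intro L' _ hL' h
    cases L' with
    | nil => rfl
    | cons b' L' =>
      exfalso
      obtain ⟨hb1', -⟩ := hB b' (hL' b' (List.mem_cons.2 (Or.inl rfl)))
      have h1 := congrArg Prod.fst h
      simp only [catBlocks_nil, catBlocks_cons] at h1
      omega
  | cons b L ih =>
    intro L' hL hL' h
    cases L' with
    | nil =>
      exfalso
      obtain ⟨hb1, -⟩ := hB b (hL b (List.mem_cons.2 (Or.inl rfl)))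
      have h1 := congrArg Prod.fst h
      simp only [catBlocks_nil, catBlocks_cons] at h1
      omega
    | cons b' L' =>
      have hLB : ∀ c ∈ L, c ∈ B := fun c hc => hL c (List.mem_cons.2 (Or.inr hc))
      have hLB' : ∀ c ∈ L', c ∈ B := fun c hc => hL' c (List.mem_cons.2 (Or.inr hc))
      obtain ⟨hbb, hLL⟩ := lbc_cons_inj hB (hL b (List.mem_cons.2 (Or.inl rfl)))
        (hL' b' (List.mem_cons.2 (Or.inl rfl))) hLB hLB' h
      rw [hbb, ih L' hLB hLB' hLL]

/-! ## Counting -/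

/-- If `φ` is injective on `S` and maps `S` into `T`, and `g ≥ 0` on `T`, then `Σ_{s ∈ S} g (φ s) ≤ Σ_{t ∈ T} g t`
(`Finset.sum_image` + `Finset.sum_le_sum_of_subset_of_nonneg`). [folklore] -/
theorem lbc_sum_le_sum_of_injOn {ι α : Type*} [DecidableEq α] {S : Finset ι} {T : Finset α}
    (φ : ι → α) (g : α → ℝ) (hinj : Set.InjOn φ ↑S) (hmaps : ∀ s ∈ S, φ s ∈ T) (hg : ∀ t ∈ T, 0 ≤ g t) :
    ∑ s ∈ S, g (φ s) ≤ ∑ t ∈ T, g t :=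
  calc ∑ s ∈ S, g (φ s) = ∑ t ∈ S.image φ, g t := (Finset.sum_image hinj).symm
    _ ≤ ∑ t ∈ T, g t :=
      Finset.sum_le_sum_of_subset_of_nonneg (Finset.image_subset_iff.2 hmaps) fun t ht _ => hg t ht

/-- Membership in the index set of `k`-tuples of blocks, `k ≤ K`: the tuple has `k ≤ K` entries, all in `B`
(`Finset.mem_sigma`, `Fintype.mem_piFinset`, `List.mem_ofFn`). [folklore] -/
theorem lbc_mem_index {B : Finset (ℕ × (ℕ → Site 2))} {K k : ℕ} {t : Fin k → ℕ × (ℕ → Site 2)}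
    (h : (⟨k, t⟩ : Σ k : ℕ, Fin k → ℕ × (ℕ → Site 2)) ∈
      (Finset.range (K + 1)).sigma (fun k => Fintype.piFinset fun _ : Fin k => B)) :
    k ≤ K ∧ ∀ c ∈ List.ofFn t, c ∈ B := by
  rw [Finset.mem_sigma, Finset.mem_range, Fintype.mem_piFinset] at h
  refine ⟨Nat.le_of_lt_succ h.1, fun c hc => ?_⟩
  obtain ⟨i, rfl⟩ := List.mem_ofFn.1 hc
  exact h.2 i

/-! ## The stub -/

/-- **S2b · `stub_bridgeCodeCount`** — BLOCK FAMILIES ARE UNIQUELY DECODABLE CODES.  For a block family `B` at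
level `ℓ` in the real direction `e` (blocks `(n, w)`: `w ∈ saws 2 n` an `e`-bridge from `0`, `1 ≤ n ≤ M`, end height
`≥ ℓ`, every renewal time in `[1, n-1]` at height `< ℓ`), every `x > 0` and every `K`:
`Σ_{k ≤ K} (Σ_{b ∈ B} x^{n_b})^k ≤ Σ_{n ≤ K M} c_n x^n`.  Expand the powers over `k`-tuples (`Finset.sum_pow'`),
map a tuple to `(total length, catBlocks)` — a self-avoiding walk of length `≤ K M` (`lbc_catBlocks_spec`),
injectively (`lbc_decode`, `List.ofFn_inj'`) — and compare with `Σ_{n ≤ KM} Σ_{ω ∈ saws 2 n} x^n = Σ c_n x^n`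
(`SAW.Zd.card_saws`, `lbc_sum_le_sum_of_injOn`). [cite: Kesten1963SAW, §4] -/
theorem stub_bridgeCodeCount :
    ∀ (e : ℂ) (ℓ : ℝ) (B : Finset (ℕ × (ℕ → Site 2))) (M : ℕ),
      (∀ b ∈ B, 1 ≤ b.1 ∧ b.1 ≤ M ∧ b.2 ∈ SAW.Zd.saws 2 b.1 ∧ IsBr e 0 b.1 b.2 ∧ ℓ ≤ ht e 0 (b.2 b.1) ∧
          ∀ s, 1 ≤ s → s < b.1 → IsRen e 0 b.2 b.1 s → ht e 0 (b.2 s) < ℓ) →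
      ∀ x : ℝ, 0 < x → ∀ K : ℕ,
        ∑ k ∈ Finset.range (K + 1), (∑ b ∈ B, x ^ b.1) ^ k ≤
          ∑ n ∈ Finset.range (K * M + 1), (SAW.Zd.count 2 n : ℝ) * x ^ n := by
  intro e ℓ B M hB x hx K
  have hL : ∑ k ∈ Finset.range (K + 1), (∑ b ∈ B, x ^ b.1) ^ k =
      ∑ p ∈ (Finset.range (K + 1)).sigma (fun k => Fintype.piFinset fun _ : Fin k => B),
        x ^ (catBlocks (List.ofFn p.2)).1 := by
    rw [Finset.sum_sigma]
    refine Finset.sum_congr rfl fun k _ => ?_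
    rw [Finset.sum_pow']
    refine Finset.sum_congr rfl fun t _ => ?_
    rw [Finset.prod_pow_eq_pow_sum, lr_catBlocks_fst, List.map_ofFn, List.sum_ofFn]
    rfl
  have hR : ∑ n ∈ Finset.range (K * M + 1), (SAW.Zd.count 2 n : ℝ) * x ^ n =
      ∑ q ∈ (Finset.range (K * M + 1)).sigma (fun n => SAW.Zd.saws 2 n), x ^ q.1 := by
    rw [Finset.sum_sigma]
    refine Finset.sum_congr rfl fun n _ => ?_
    simp only [Finset.sum_const, SAW.Zd.card_saws, nsmul_eq_mul]
  rw [hL, hR]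
  refine lbc_sum_le_sum_of_injOn
    (fun p : (Σ k : ℕ, Fin k → ℕ × (ℕ → Site 2)) =>
      (⟨(catBlocks (List.ofFn p.2)).1, (catBlocks (List.ofFn p.2)).2⟩ : Σ _ : ℕ, ℕ → Site 2))
    (fun q => x ^ q.1) ?_ ?_ (fun q _ => pow_nonneg hx.le _)
  · rintro ⟨k, t⟩ hp ⟨k', t'⟩ hq h
    obtain ⟨-, hmem⟩ := lbc_mem_index (Finset.mem_coe.1 hp)
    obtain ⟨-, hmem'⟩ := lbc_mem_index (Finset.mem_coe.1 hq)
    have hcat : catBlocks (List.ofFn t) = catBlocks (List.ofFn t') := by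
      simp only [Sigma.mk.injEq, heq_eq_eq] at h
      exact Prod.ext h.1 h.2
    exact List.ofFn_inj'.1 (lbc_decode hB _ _ hmem hmem' hcat)
  · rintro ⟨k, t⟩ hp
    obtain ⟨hk, hmem⟩ := lbc_mem_index hp
    obtain ⟨hs, -, hlen⟩ := lbc_catBlocks_spec hB _ hmem
    rw [List.length_ofFn] at hlen
    refine Finset.mem_sigma.2 ⟨Finset.mem_range.2 ?_, hs⟩
    exact Nat.lt_succ_of_le (hlen.trans (Nat.mul_le_mul hk le_rfl))

end Summit.CriticalPhenomena.SAWScalingLimit.Theorems.AnnularMassDecay.LastRenewal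

end
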